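import Summits.QuantumFields.YangMills.Theorems.Instrument.BesselCapLimit
import Summits.QuantumFields.GaugeBoot.BesselCapColumn
import HarnessLib

/-!
# YM instrument cell — `SU(2)`, `D = 4`: the ONE-SIDED Bessel cap `|W̄(R×T)| ≤ ρ^T` for every `R ≥ 1` (width-one
# column `λ₁ = ρ`), on every torus and at infinite-volume LIMIT POINTS (`|g_m(t)| ≤ ρ^t`, every `m ≥ 1`)

Cell `ym-instrument` (HUMAN RULING D-0084 (2); director-ym R138; HOME `run/shared/lean/pub/ym-instrument/`), crew (a),
Lean typist seat `ym-instrument-boot-lean-1` (gen 3). Question Q-A1, amendment A-plan-11 «BESSEL CAP», class-LIMIT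
COROLLARY (support cap `supp μ_m ⊂ [0, λ_m]`, `λ₁ = ρ`, `λ_{m ≥ 2} = ρ²`; boot-plan AMEND A-plan-10 §1 / v2 §1 (B2)); this
file supplies the `m = 1` input `λ₁ = ρ` asked by boot-plan 2026-08-27T03:22:18Z (3) and named in ACT-D (T-a); ladder
consequence: the «LIMIT | cap» rows of TABLE-A1 (IR `stmt-QuantumFields-19354`, THE NUMBER) — provenance only, no number moves.

HONEST FRAMING (page 1 of every file of this cell): WHAT IS CERTIFIED HERE, AT WHICH `(G, D, L, β)`: `G = SU(2)`
(fundamental, standard Wilson action, tree coupling `β/2`), `D = 4`; (i) on EVERY torus `(ℤ/L)⁴` with `L ≥ max(R,T) + 3`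
(even or odd), at every base point and in every coordinate plane, `|⟨W_{R×T}⟩_β| ≤ ρ(β)^T` for `R ≥ 1` and `≤ ρ(β)^R` for
`T ≥ 1` (`β ∈ {9/5, 2, 11/5, 12/5}` hypothesis-free with the rational `ρ(β)` of record `2177/2500, 2207/2500, 558/625,
9013/10000`; general `β > 0` under the point hypothesis `I₂(6β)/I₁(6β) ≤ ρ`); (ii) for EVERY infinite-volume limit point
`μ` of the torus Wilson states along ANY strictly increasing sequence of tori, in the notation of
`GaugeBoot/WilsonLoopLimitMonotone`, `g_m(t) = ∫ W̄(t × m) dμ` satisfies `|g_m(t)| ≤ ρ^t` for every `t` as soon as `m ≥ 1`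
(for `m ≥ 2` the two-sided file `BesselCapLimit` gives the better `ρ^{2t}`). Witness: ONE long side of the rectangle
(`GaugeBoot/BesselCapColumn.capCheck_rectangle_right`). Fixed-coupling, `R`-independent perimeter-type bounds; NOT an area
law, NOT a string tension, NOT a mass gap, no continuum statement, no uniqueness of the limit claimed; nothing
summit-bearing; no hypothesis left to the reader in the per-`β` theorems. The Hausdorff-moment representation is NOT
formalised (file `BesselCapLimitHankel` carries its finite content).
-/

noncomputable section

namespace Summit.QuantumFields.YangMills.Theorems.Instrument

open MeasureTheory Filter Topology
open Summit.QuantumFields.GaugeBoot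
open Literature.MathematicalPhysics.QuantumFieldTheory
open Literature.MathematicalPhysics.QuantumLattice (LGConfig IsInfiniteVolumeLimitAlong wilsonLoopObs rectWalk
  isCylinder_wilsonLoopObs continuous_wilsonLoopObs exists_abs_wilsonLoopObs_le normalisedCharacter
  continuous_normalisedCharacter_comp)
open Literature.Analysis.FunctionSpaces (besselI)

/-! ## Torus-averaged loops: `|⟨W̄(R×T)⟩| ≤ ρ^T` for every `R ≥ 1` -/

/-- **`|⟨W̄(R×T)⟩_β| ≤ ρ^T`** for `SU(2)`, `D = 4`, `R ≥ 1`, every `T`, every torus `L` with `R + 3 ≤ L`, `T + 3 ≤ L`,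
whenever `0 < β`, `0 ≤ ρ`, `I₂(6β)/I₁(6β) ≤ ρ` (one-sided witness `rightColumn`). [folklore] -/
theorem abs_wilsonLoop_le_pow_right_of_besselRatio_le {β ρ : ℝ} (hβ : 0 < β) (hρ0 : 0 ≤ ρ)
    (hρ : besselI 2 (6 * β) / besselI 1 (6 * β) ≤ ρ) {R T : ℕ} (hR : 1 ≤ R) (L : ℕ) [NeZero L]
    (hRL : R + 3 ≤ L) (hTL : T + 3 ≤ L) : |wilsonLoopExpectation 2 4 L β R T| ≤ ρ ^ T := by
  rw [wilsonLoopExpectation_two_four_eq]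
  have h := abs_W_le_pow_of_capCheck hβ hρ0 hρ (capCheck_rectangle_right 0 1 (by decide) hR hRL hTL) L le_rfl
  rwa [length_rightColumn] at h

/-- **`|⟨W̄(R×T)⟩_β| ≤ ρ^R`** for `T ≥ 1`, every `R` (axis exchange `wilsonLoopExpectation_comm`). [folklore] -/
theorem abs_wilsonLoop_le_pow_left_of_besselRatio_le {β ρ : ℝ} (hβ : 0 < β) (hρ0 : 0 ≤ ρ)
    (hρ : besselI 2 (6 * β) / besselI 1 (6 * β) ≤ ρ) {R T : ℕ} (hT : 1 ≤ T) (L : ℕ) [NeZero L]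
    (hRL : R + 3 ≤ L) (hTL : T + 3 ≤ L) : |wilsonLoopExpectation 2 4 L β R T| ≤ ρ ^ R := by
  rw [wilsonLoopExpectation_comm (by norm_num) L β R T]
  exact abs_wilsonLoop_le_pow_right_of_besselRatio_le hβ hρ0 hρ hT L hTL hRL

/-- **`|⟨W̄(R×T)⟩| ≤ (2177/2500)^T` at `β_std = 9/5`** (`R ≥ 1`, all `T`, every torus `L ≥ max(R,T)+3`). [folklore] -/
theorem abs_wilsonLoop_le_pow_right_SU2_D4_b9o5 {R T : ℕ} (hR : 1 ≤ R) (L : ℕ) [NeZero L] (hRL : R + 3 ≤ L)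
    (hTL : T + 3 ≤ L) : |wilsonLoopExpectation 2 4 L (9 / 5) R T| ≤ (2177 / 2500 : ℝ) ^ T :=
  abs_wilsonLoop_le_pow_right_of_besselRatio_le (by norm_num) (by norm_num) besselRatio_b9o5_le hR L hRL hTL

/-- **`|⟨W̄(R×T)⟩| ≤ (2207/2500)^T` at `β_std = 2`** (`R ≥ 1`). [folklore] -/
theorem abs_wilsonLoop_le_pow_right_SU2_D4_b2 {R T : ℕ} (hR : 1 ≤ R) (L : ℕ) [NeZero L] (hRL : R + 3 ≤ L)
    (hTL : T + 3 ≤ L) : |wilsonLoopExpectation 2 4 L 2 R T| ≤ (2207 / 2500 : ℝ) ^ T :=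
  abs_wilsonLoop_le_pow_right_of_besselRatio_le (by norm_num) (by norm_num) besselRatio_b2_le hR L hRL hTL

/-- **`|⟨W̄(R×T)⟩| ≤ (558/625)^T` at `β_std = 11/5`** (`R ≥ 1`). [folklore] -/
theorem abs_wilsonLoop_le_pow_right_SU2_D4_b11o5 {R T : ℕ} (hR : 1 ≤ R) (L : ℕ) [NeZero L] (hRL : R + 3 ≤ L)
    (hTL : T + 3 ≤ L) : |wilsonLoopExpectation 2 4 L (11 / 5) R T| ≤ (558 / 625 : ℝ) ^ T :=
  abs_wilsonLoop_le_pow_right_of_besselRatio_le (by norm_num) (by norm_num) besselRatio_b11o5_le hR L hRL hTL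

/-- **`|⟨W̄(R×T)⟩| ≤ (9013/10000)^T` at `β_std = 12/5`** (`R ≥ 1`). [folklore] -/
theorem abs_wilsonLoop_le_pow_right_SU2_D4_b12o5 {R T : ℕ} (hR : 1 ≤ R) (L : ℕ) [NeZero L] (hRL : R + 3 ≤ L)
    (hTL : T + 3 ≤ L) : |wilsonLoopExpectation 2 4 L (12 / 5) R T| ≤ (9013 / 10000 : ℝ) ^ T :=
  abs_wilsonLoop_le_pow_right_of_besselRatio_le (by norm_num) (by norm_num) besselRatio_b12o5_le hR L hRL hTL

/-! ## Torus: every base point, every plane, both orientations -/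

/-- **Torus cap, one-sided, long second side**: `|⟨W_{R×T}(x; i, j)⟩_β| ≤ ρ^T` for `R ≥ 1`, every torus `L` with
`R + 3 ≤ L`, `T + 3 ≤ L` (general `β > 0`, point hypothesis on `I₂/I₁(6β)`). [folklore] -/
theorem abs_wilsonExpectation_wilsonLoop_le_pow_right {β ρ : ℝ} (hβ : 0 < β) (hρ0 : 0 ≤ ρ)
    (hρ : besselI 2 (6 * β) / besselI 1 (6 * β) ≤ ρ) {R T : ℕ} (hR : 1 ≤ R) (L : ℕ) [NeZero L] (hRL : R + 3 ≤ L)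
    (hTL : T + 3 ≤ L) (x : Site 4 L) {i j : Fin 4} (hij : i ≠ j) :
    |wilsonExpectation (suRep 2) (β / (2 : ℕ)) (wilsonLoop (suRep 2) x i j R T)| ≤ ρ ^ T := by
  rw [wilsonExpectation_wilsonLoop_eq_wilsonLoopExpectation L β x hij]
  exact abs_wilsonLoop_le_pow_right_of_besselRatio_le hβ hρ0 hρ hR L hRL hTL

/-- **Torus cap, one-sided, long first side**: `|⟨W_{R×T}(x; i, j)⟩_β| ≤ ρ^R` for `T ≥ 1`. [folklore] -/
theorem abs_wilsonExpectation_wilsonLoop_le_pow_left {β ρ : ℝ} (hβ : 0 < β) (hρ0 : 0 ≤ ρ)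
    (hρ : besselI 2 (6 * β) / besselI 1 (6 * β) ≤ ρ) {R T : ℕ} (hT : 1 ≤ T) (L : ℕ) [NeZero L] (hRL : R + 3 ≤ L)
    (hTL : T + 3 ≤ L) (x : Site 4 L) {i j : Fin 4} (hij : i ≠ j) :
    |wilsonExpectation (suRep 2) (β / (2 : ℕ)) (wilsonLoop (suRep 2) x i j R T)| ≤ ρ ^ R := by
  rw [wilsonExpectation_wilsonLoop_eq_wilsonLoopExpectation L β x hij]
  exact abs_wilsonLoop_le_pow_left_of_besselRatio_le hβ hρ0 hρ hT L hRL hTL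

/-! ## Infinite-volume limit points along any increasing sequence of tori -/

/-- **LIMIT-POINT CAP, one-sided.** Let `μ` be an infinite-volume limit point of the `SU(2)`, `D = 4` torus Wilson states
at standard coupling `β > 0` along a strictly increasing sequence of tori `(ℤ/(L_k+1))⁴` (no parity assumption), and let
`I₂(6β)/I₁(6β) ≤ ρ`, `0 ≤ ρ`. Then for every base point `x ∈ ℤ⁴`, plane `i ≠ j` and `R ≥ 1`:
`|∫ W_{R×T}(x; i, j) dμ| ≤ ρ^T` for EVERY `T`. [folklore] -/
theorem abs_integral_limit_wilsonLoop_le_pow_right {β ρ : ℝ} (hβ : 0 < β) (hρ0 : 0 ≤ ρ)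
    (hρ : besselI 2 (6 * β) / besselI 1 (6 * β) ≤ ρ) {R T : ℕ} (hR : 1 ≤ R) {Lk : ℕ → ℕ} (hmono : StrictMono Lk)
    {μ : Measure (LGConfig 4 (SU 2))} (hμ : IsInfiniteVolumeLimitAlong (suRep 2) (β / (2 : ℕ)) Lk μ)
    (x : Literature.Probability.LatticeModels.Site 4) {i j : Fin 4} (hij : i ≠ j) :
    |∫ U, wilsonLoopObs (normalisedCharacter 2 ∘ suRep 2) (rectWalk x i j R T) U ∂μ| ≤ ρ ^ T := by
  have hχ := continuous_normalisedCharacter_comp (N := 2) (continuous_suRep 2)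
  have hlim := hμ.2 _ _ (isCylinder_wilsonLoopObs (normalisedCharacter 2 ∘ suRep 2) (rectWalk x i j R T))
    (continuous_wilsonLoopObs hχ _) (exists_abs_wilsonLoopObs_le hχ _)
  simp only [Summit.QuantumFields.GaugeBoot.toTorusObservable_wilsonLoopObs_rectWalk] at hlim
  have hev : ∀ᶠ k in atTop, |wilsonExpectation (suRep 2) (β / (2 : ℕ))
      (wilsonLoop (suRep 2) (Literature.Probability.LatticeModels.Torus.proj (Lk k + 1) x) i j R T)| ≤ ρ ^ T :=
    Filter.eventually_atTop.2 ⟨R + T + 3, fun k hk => by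
      have hk' : R + T + 3 ≤ Lk k + 1 := (hk.trans (hmono.id_le k)).trans (Nat.le_succ _)
      exact abs_wilsonExpectation_wilsonLoop_le_pow_right hβ hρ0 hρ hR (Lk k + 1) (by omega) (by omega) _ hij⟩
  rw [abs_le]
  exact ⟨ge_of_tendsto hlim (hev.mono fun k hk => (abs_le.1 hk).1), le_of_tendsto hlim (hev.mono fun k hk => (abs_le.1 hk).2)⟩

/-- **LIMIT-POINT CAP, one-sided, long first side**: `|∫ W_{R×T}(x; i, j) dμ| ≤ ρ^R` for `T ≥ 1`, every `R`. [folklore] -/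
theorem abs_integral_limit_wilsonLoop_le_pow_left {β ρ : ℝ} (hβ : 0 < β) (hρ0 : 0 ≤ ρ)
    (hρ : besselI 2 (6 * β) / besselI 1 (6 * β) ≤ ρ) {R T : ℕ} (hT : 1 ≤ T) {Lk : ℕ → ℕ} (hmono : StrictMono Lk)
    {μ : Measure (LGConfig 4 (SU 2))} (hμ : IsInfiniteVolumeLimitAlong (suRep 2) (β / (2 : ℕ)) Lk μ)
    (x : Literature.Probability.LatticeModels.Site 4) {i j : Fin 4} (hij : i ≠ j) :
    |∫ U, wilsonLoopObs (normalisedCharacter 2 ∘ suRep 2) (rectWalk x i j R T) U ∂μ| ≤ ρ ^ R := by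
  have hχ := continuous_normalisedCharacter_comp (N := 2) (continuous_suRep 2)
  have hlim := hμ.2 _ _ (isCylinder_wilsonLoopObs (normalisedCharacter 2 ∘ suRep 2) (rectWalk x i j R T))
    (continuous_wilsonLoopObs hχ _) (exists_abs_wilsonLoopObs_le hχ _)
  simp only [Summit.QuantumFields.GaugeBoot.toTorusObservable_wilsonLoopObs_rectWalk] at hlim
  have hev : ∀ᶠ k in atTop, |wilsonExpectation (suRep 2) (β / (2 : ℕ))
      (wilsonLoop (suRep 2) (Literature.Probability.LatticeModels.Torus.proj (Lk k + 1) x) i j R T)| ≤ ρ ^ R :=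
    Filter.eventually_atTop.2 ⟨R + T + 3, fun k hk => by
      have hk' : R + T + 3 ≤ Lk k + 1 := (hk.trans (hmono.id_le k)).trans (Nat.le_succ _)
      exact abs_wilsonExpectation_wilsonLoop_le_pow_left hβ hρ0 hρ hT (Lk k + 1) (by omega) (by omega) _ hij⟩
  rw [abs_le]
  exact ⟨ge_of_tendsto hlim (hev.mono fun k hk => (abs_le.1 hk).1), le_of_tendsto hlim (hev.mono fun k hk => (abs_le.1 hk).2)⟩

/-! ## The hypothesis-free limit rows at the Q-A1 couplings: `|g_m(t)| ≤ ρ(β)^t`, every `m ≥ 1`, all `t` -/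

/-- **One-sided LIMIT cap at `β_std = 9/5`**: for every limit point along any increasing sequence of tori and every `t`,
`|∫ W̄(t × m) dμ| ≤ (2177/2500)^t` when `m ≥ 1` (plane `(0, j)`, any `j ≠ 0`, any base point); in particular the
width-one column `m = 1` (`λ₁ = ρ`). [folklore] -/
theorem abs_limit_wilsonLoop_le_pow_one_b9o5 {Lk : ℕ → ℕ} (hmono : StrictMono Lk) {μ : Measure (LGConfig 4 (SU 2))}
    (hμ : IsInfiniteVolumeLimitAlong (suRep 2) ((9 / 5 : ℝ) / (2 : ℕ)) Lk μ) (x : Literature.Probability.LatticeModels.Site 4)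
    {j : Fin 4} (hj : j ≠ 0) {m : ℕ} (hm : 1 ≤ m) (t : ℕ) :
    |∫ U, wilsonLoopObs (normalisedCharacter 2 ∘ suRep 2) (rectWalk x 0 j t m) U ∂μ| ≤ (2177 / 2500 : ℝ) ^ t :=
  abs_integral_limit_wilsonLoop_le_pow_left (by norm_num) (by norm_num) besselRatio_b9o5_le hm hmono hμ x hj.symm

/-- **One-sided LIMIT cap at `β_std = 2`**: `|∫ W̄(t × m) dμ| ≤ (2207/2500)^t` (`m ≥ 1`, all `t`). [folklore] -/
theorem abs_limit_wilsonLoop_le_pow_one_b2 {Lk : ℕ → ℕ} (hmono : StrictMono Lk) {μ : Measure (LGConfig 4 (SU 2))}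
    (hμ : IsInfiniteVolumeLimitAlong (suRep 2) ((2 : ℝ) / (2 : ℕ)) Lk μ) (x : Literature.Probability.LatticeModels.Site 4)
    {j : Fin 4} (hj : j ≠ 0) {m : ℕ} (hm : 1 ≤ m) (t : ℕ) :
    |∫ U, wilsonLoopObs (normalisedCharacter 2 ∘ suRep 2) (rectWalk x 0 j t m) U ∂μ| ≤ (2207 / 2500 : ℝ) ^ t :=
  abs_integral_limit_wilsonLoop_le_pow_left (by norm_num) (by norm_num) besselRatio_b2_le hm hmono hμ x hj.symm

/-- **One-sided LIMIT cap at `β_std = 11/5`**: `|∫ W̄(t × m) dμ| ≤ (558/625)^t` (`m ≥ 1`, all `t`). [folklore] -/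
theorem abs_limit_wilsonLoop_le_pow_one_b11o5 {Lk : ℕ → ℕ} (hmono : StrictMono Lk) {μ : Measure (LGConfig 4 (SU 2))}
    (hμ : IsInfiniteVolumeLimitAlong (suRep 2) ((11 / 5 : ℝ) / (2 : ℕ)) Lk μ)
    (x : Literature.Probability.LatticeModels.Site 4) {j : Fin 4} (hj : j ≠ 0) {m : ℕ} (hm : 1 ≤ m) (t : ℕ) :
    |∫ U, wilsonLoopObs (normalisedCharacter 2 ∘ suRep 2) (rectWalk x 0 j t m) U ∂μ| ≤ (558 / 625 : ℝ) ^ t :=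
  abs_integral_limit_wilsonLoop_le_pow_left (by norm_num) (by norm_num) besselRatio_b11o5_le hm hmono hμ x hj.symm

/-- **One-sided LIMIT cap at `β_std = 12/5`**: `|∫ W̄(t × m) dμ| ≤ (9013/10000)^t` (`m ≥ 1`, all `t`). [folklore] -/
theorem abs_limit_wilsonLoop_le_pow_one_b12o5 {Lk : ℕ → ℕ} (hmono : StrictMono Lk) {μ : Measure (LGConfig 4 (SU 2))}
    (hμ : IsInfiniteVolumeLimitAlong (suRep 2) ((12 / 5 : ℝ) / (2 : ℕ)) Lk μ)
    (x : Literature.Probability.LatticeModels.Site 4) {j : Fin 4} (hj : j ≠ 0) {m : ℕ} (hm : 1 ≤ m) (t : ℕ) :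
    |∫ U, wilsonLoopObs (normalisedCharacter 2 ∘ suRep 2) (rectWalk x 0 j t m) U ∂μ| ≤ (9013 / 10000 : ℝ) ^ t :=
  abs_integral_limit_wilsonLoop_le_pow_left (by norm_num) (by norm_num) besselRatio_b12o5_le hm hmono hμ x hj.symm

end Summit.QuantumFields.YangMills.Theorems.Instrument

end
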